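import Summits.ValiantsHypothesis.ValiantsHypothesis.Theorems.RigidityForcesSymmetryGrenetFirstOrderRankRigidBorderShape

/-!
# Route RigidityForcesSymmetry — `GrenetFirstOrderRankRigid` (item stmt-ValiantsHypothesis-21029),
line `grenet_gauge`: stub `stub_linearRigid`, step 5 (block II, top border) — the tail entries of a
pair `(univ, T)`

For the crux line `Cruxes/GrenetFirstOrderRankRigid/Lines/grenet_gauge.lean` (blueprint
`Lines/grenet_gauge-stub_linearRigid-PROOF.md`, §5, block II, border `k = n - a`; binder `hTu` of
`grenet_linearRigid_of_blockII`, `…FinalModuloII`).  The tail entries `ρ_y := (A'_(y, n-1)) (row univ - y)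
(col T)`, `y : Fin n`, of a homogeneous, rank-constrained tangent direction at Grenet's pencil form one
torus-weight block (row weight `1 + 1_{Tᶜ}`, column weight `1 + 1_{[|T|, n)}`); the rank constraint
leaves no other entry in it (`border_column_shape`).  For `x ∈ T` and `p' ∉ T` evaluate the block at
the permutation point of an ordering `π` listing `T - x + p'` first, then `Tᶜ - p'`, then `x`, with the
EXTRA CELL `(p', n-1)` (`evalPermExtra_grenet_W`, val-width-21029-p2): only `ρ_x` (through
`W ∅ (univ - x) · x_{x,n-1} · W T univ`, the path `T → univ` ending through the extra cell) and `ρ_{p'}`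
(through `per_n · x_{p',n-1} · W T (univ - p')`) survive, with opposite signs: `ρ_{p'} = ρ_x`
(`grenet_borderTu_core`).  Hence all `ρ_y` agree (`grenet_borderTu`, the binder `hTu`).

No new definitions.  VP ≠ VNP is not moved by this file.
-/

noncomputable section

open MvPolynomial Matrix Finset

namespace Summit.ValiantsHypothesis.Theorems.RigidityForcesSymmetry.GrenetGauge

open Literature.Computability.AlgebraicComplexity

/-! ### The top border block -/

section BorderTu

variable {k : Type*} [CommRing k] [IsDomain k] {n N : ℕ} (e : Finset (Fin n) ≃ Fin (N + 1))

/-- **Two tail entries of a pair `(univ, T)` across `T`.**  For `x ∈ T = C j`, `p' ∉ T`, rows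
`R i₁ = univ - x`, `R i₂ = univ - p'` and the top level `cN = n - 1`:
`A'_(p', cN) i₂ j = A'_(x, cN) i₁ j` (evaluate the weight block of the tail entry `(i₁, j, (x, cN))` at the
permutation-with-extra-cell point described in the module docstring). [cite: Grenet2011, Thm. 1] -/
theorem grenet_borderTu_core (hn : n ≠ 0) (hN : 2 ^ n = N + 1)
    (A' : Fin n × Fin n → Matrix (Fin N) (Fin N) k)
    (htr : ((Grenet.repr k n e).adjugate * ∑ v, (X v : MvPolynomial (Fin n × Fin n) k) • (A' v).map C).trace = 0)
    (hsupp : ∀ (w : Fin n × Fin n) (a b : Fin N), A' w a b ≠ 0 →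
      (w.1 ∉ e.symm ((e univ).succAbove a) ∧ (w.2 : ℕ) = (e.symm ((e univ).succAbove a)).card) ∨
      (w.1 ∈ e.symm ((e ∅).succAbove b) ∧ (e.symm ((e ∅).succAbove b)).card = (w.2 : ℕ) + 1))
    {i₁ i₂ j : Fin N} {x p' cN : Fin n} (hx : x ∈ e.symm ((e ∅).succAbove j))
    (hp' : p' ∉ e.symm ((e ∅).succAbove j)) (hi₁ : e.symm ((e univ).succAbove i₁) = univ.erase x)
    (hi₂ : e.symm ((e univ).succAbove i₂) = univ.erase p') (hcN : (cN : ℕ) = n - 1) :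
    A' (p', cN) i₂ j = A' (x, cN) i₁ j := by
  classical
  set T := e.symm ((e ∅).succAbove j) with hTdef
  set S := e.symm ((e univ).succAbove i₁) with hSdef
  have hRinj : ∀ a b : Fin N, e.symm ((e univ).succAbove a) = e.symm ((e univ).succAbove b) → a = b :=
    fun a b h => Fin.succAbove_right_injective (e.symm.injective h)
  have hCinj : ∀ a b : Fin N, e.symm ((e ∅).succAbove a) = e.symm ((e ∅).succAbove b) → a = b :=
    fun a b h => Fin.succAbove_right_injective (e.symm.injective h)
  have hxp : x ≠ p' := fun h => hp' (h ▸ hx)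
  have hn2 : 2 ≤ n := by
    have h1 : ({x, p'} : Finset (Fin n)).card ≤ n := (Finset.card_le_univ _).trans_eq (Fintype.card_fin n)
    rw [Finset.card_pair hxp] at h1
    exact h1
  have hScard : S.card = n - 1 := by rw [hi₁, Finset.card_erase_of_mem (Finset.mem_univ _), Finset.card_univ, Fintype.card_fin]
  have hTn : T.card ≤ n - 1 := by
    have h1 : T.card < n := by
      have := Finset.card_lt_card (Finset.ssubset_iff_subset_ne.mpr ⟨Finset.subset_univ T,
        fun h => hp' (h.symm ▸ Finset.mem_univ _)⟩)
      rwa [Finset.card_univ, Fintype.card_fin] at this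
    omega
  -- the ordering `π`: `T - x + p'` first, then `Tᶜ - p'`, then `x`; the extra cell is `(p', n - 1)`
  set L := insert p' (T.erase x) with hL
  have hLcard : L.card = T.card := by
    rw [hL, Finset.card_insert_of_notMem (fun h => hp' (Finset.mem_of_mem_erase h)),
      Finset.card_erase_of_mem hx]
    have := Finset.card_pos.mpr ⟨x, hx⟩
    omega
  have hxL : x ∉ L := by
    rw [hL, Finset.mem_insert, not_or]
    exact ⟨hxp, Finset.notMem_erase _ _⟩
  obtain ⟨π, hπL, hπx⟩ := exists_perm_prefix_last L x hxL
  rw [hLcard] at hπL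
  have hπcN : π cN = x := hπx cN hcN
  set c₁ := π.symm p' with hc₁
  have hπc₁ : π c₁ = p' := Equiv.apply_symm_apply π p'
  have hc₁k : (c₁ : ℕ) < T.card := by
    have : p' ∈ (univ.filter fun i : Fin n => (i : ℕ) < T.card).image π := by
      rw [hπL, hL]; exact Finset.mem_insert_self _ _
    exact (Grenet.mem_prefix_image π _ p').mp this
  have hc₀₁ : cN ≠ c₁ := fun h => hxp (by rw [← hπcN, h, hπc₁])
  -- membership in the prefix and position of `x`
  have hmemL : ∀ y : Fin n, ((π.symm y : Fin n) : ℕ) < T.card ↔ y ∈ L := fun y => by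
    rw [← Grenet.mem_prefix_image π, hπL]
  have hposx : ∀ y : Fin n, ((π.symm y : Fin n) : ℕ) = n - 1 ↔ y = x := fun y => by
    constructor
    · intro h; rw [← Equiv.apply_symm_apply π y]; exact hπx _ h
    · intro h; rw [h, ← hπcN, Equiv.symm_apply_apply]; exact hcN
  -- the slices of `π`
  have hslice1 : (univ.filter fun c : Fin n => (∅ : Finset (Fin n)).card ≤ (c : ℕ) ∧
      (c : ℕ) < (univ : Finset (Fin n)).card).image π = univ := by
    apply Finset.eq_univ_of_forall
    intro y
    rw [mem_permSlice, Finset.card_empty, Finset.card_univ, Fintype.card_fin]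
    exact ⟨Nat.zero_le _, (π.symm y).isLt⟩
  have hslice2 : ∀ y : Fin n, (univ.filter fun c : Fin n => (∅ : Finset (Fin n)).card ≤ (c : ℕ) ∧
      (c : ℕ) < (univ.erase y).card).image π = univ.erase x := by
    intro y
    ext z
    rw [mem_permSlice, Finset.card_empty, Finset.card_erase_of_mem (Finset.mem_univ y), Finset.card_univ,
      Fintype.card_fin, Finset.mem_erase]
    have h1 := hposx z
    have h2 := (π.symm z).isLt
    constructor
    · intro h; exact ⟨fun h' => by have := h1.mpr h'; omega, Finset.mem_univ _⟩
    · intro h; refine ⟨Nat.zero_le _, ?_⟩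
      rcases Nat.lt_or_ge ((π.symm z : Fin n) : ℕ) (n - 1) with h' | h'
      · exact h'
      · exact absurd (h1.mp (by omega)) h.1
  have hslice4 : ∀ y : Fin n, (univ.filter fun c : Fin n => T.card ≤ (c : ℕ) ∧
      (c : ℕ) < (univ.erase y).card).image π = Tᶜ.erase p' := by
    intro y
    ext z
    rw [mem_permSlice, Finset.card_erase_of_mem (Finset.mem_univ y), Finset.card_univ, Fintype.card_fin,
      Finset.mem_erase, Finset.mem_compl]
    have h1 := hposx z
    have h2 := hmemL z
    have h3 := (π.symm z).isLt
    rw [hL, Finset.mem_insert, Finset.mem_erase] at h2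
    constructor
    · rintro ⟨ha, hb⟩
      have hzL : ¬ (z = p' ∨ z ≠ x ∧ z ∈ T) := fun h' => by have := h2.mpr h'; omega
      have hzx : z ≠ x := fun h' => by have := h1.mpr h'; omega
      rw [not_or, not_and] at hzL
      exact ⟨hzL.1, fun h' => hzL.2 hzx h'⟩
    · rintro ⟨hzp, hzT⟩
      have hzx : z ≠ x := fun h' => hzT (h' ▸ hx)
      constructor
      · by_contra h'
        rcases h2.mp (by omega) with h'' | h''
        · exact hzp h''
        · exact hzT h''.2
      · rcases Nat.lt_or_ge ((π.symm z : Fin n) : ℕ) (n - 1) with h' | h'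
        · exact h'
        · exact absurd (h1.mp (by omega)) hzx
  have hslice3 : (univ.filter fun c : Fin n => T.card ≤ (c : ℕ) ∧
      (c : ℕ) < (univ : Finset (Fin n)).card).image π = insert x (Tᶜ.erase p') := by
    rw [Finset.card_univ, Fintype.card_fin, permSlice_succ_right π (by omega) le_rfl, ← hslice4 x,
      Finset.card_erase_of_mem (Finset.mem_univ x), Finset.card_univ, Fintype.card_fin]
    congr 1
    exact hπx _ rfl
  -- the four evaluations at the point
  have hcNy : ∀ y : Fin n, ¬ ((cN : ℕ) < (univ.erase y).card) := fun y => by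
    rw [Finset.card_erase_of_mem (Finset.mem_univ y), Finset.card_univ, Fintype.card_fin]; omega
  have hEper : eval (fun v : Fin n × Fin n => if π v.2 = v.1 ∨ (v.2 = cN ∧ v.1 = π c₁) then (1 : k) else 0)
      (perPoly (Fin n) k) = 1 := by
    rw [← grenet_W_empty_univ, evalPermExtra_grenet_W k π cN c₁ hc₀₁ ∅ univ (by simp), hslice1]
    have h1 : ¬ ¬ ((∅ : Finset (Fin n)).card ≤ (c₁ : ℕ) ∧ (c₁ : ℕ) < (univ : Finset (Fin n)).card) := fun h =>
      h ⟨by simp, by rw [Finset.card_univ, Fintype.card_fin]; exact c₁.isLt⟩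
    simp only [h1, false_and, and_false, reduceIte, add_zero]
    exact if_pos ⟨Finset.disjoint_empty_left _, Finset.empty_union _⟩
  have hES : ∀ y : Fin n, eval (fun v : Fin n × Fin n => if π v.2 = v.1 ∨ (v.2 = cN ∧ v.1 = π c₁) then (1 : k) else 0)
      ((1 - Grenet.adj k n).adjugate ∅ (univ.erase y)) = if y = x then 1 else 0 := by
    intro y
    rw [evalPermExtra_grenet_W k π cN c₁ hc₀₁ ∅ (univ.erase y) (by simp), hslice2 y]
    simp only [hcNy y, false_and, and_false, reduceIte, add_zero]
    by_cases hy : y = x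
    · rw [if_pos hy, if_pos ⟨Finset.disjoint_empty_left _, by rw [Finset.empty_union, hy]⟩]
    · rw [if_neg hy, if_neg]
      rintro ⟨-, h⟩
      rw [Finset.empty_union] at h
      have hy' : y ∈ univ.erase x := Finset.mem_erase.mpr ⟨hy, Finset.mem_univ _⟩
      rw [h] at hy'
      exact Finset.notMem_erase y univ hy'
  have hET : eval (fun v : Fin n × Fin n => if π v.2 = v.1 ∨ (v.2 = cN ∧ v.1 = π c₁) then (1 : k) else 0)
      ((1 - Grenet.adj k n).adjugate T univ) = 1 := by
    have hxTc : x ∉ Tᶜ.erase p' := fun h => (Finset.mem_compl.mp (Finset.mem_of_mem_erase h)) hx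
    rw [evalPermExtra_grenet_W k π cN c₁ hc₀₁ T univ (Finset.card_le_card (Finset.subset_univ T)), hslice3,
      hπc₁, hπcN, Finset.erase_insert hxTc, Finset.insert_erase (Finset.mem_compl.mpr hp'),
      if_neg (fun h => Finset.disjoint_left.mp h.1 hx (Finset.mem_insert_self _ _)), zero_add]
    refine if_pos ⟨by omega, by rw [Finset.card_univ, Fintype.card_fin]; omega, fun h => by omega,
      disjoint_compl_right, Finset.union_compl T⟩
  have hETY : ∀ y : Fin n, eval (fun v : Fin n × Fin n => if π v.2 = v.1 ∨ (v.2 = cN ∧ v.1 = π c₁) then (1 : k) else 0)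
      ((1 - Grenet.adj k n).adjugate T (univ.erase y)) = if y = p' then 1 else 0 := by
    intro y
    have hcard : T.card ≤ (univ.erase y).card := by
      rw [Finset.card_erase_of_mem (Finset.mem_univ y), Finset.card_univ, Fintype.card_fin]; exact hTn
    rw [evalPermExtra_grenet_W k π cN c₁ hc₀₁ T (univ.erase y) hcard, hslice4 y]
    simp only [hcNy y, false_and, and_false, reduceIte, add_zero]
    have hdisj : Disjoint T (Tᶜ.erase p') :=
      Finset.disjoint_left.mpr fun z hz hz' => Finset.mem_compl.mp (Finset.mem_of_mem_erase hz') hz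
    have hTu : T ∪ Tᶜ.erase p' = univ.erase p' := by
      ext z
      simp only [Finset.mem_union, Finset.mem_erase, Finset.mem_compl, Finset.mem_univ, and_true]
      constructor
      · rintro (h | ⟨h1, -⟩)
        · exact fun h' => hp' (h' ▸ h)
        · exact h1
      · intro h
        by_cases hz : z ∈ T
        · exact Or.inl hz
        · exact Or.inr ⟨h, hz⟩
    rw [hTu]
    by_cases hy : y = p'
    · rw [if_pos hy, if_pos ⟨hdisj, by rw [hy]⟩]
    · rw [if_neg hy, if_neg]
      rintro ⟨-, h⟩
      have hy' : y ∈ univ.erase p' := Finset.mem_erase.mpr ⟨hy, Finset.mem_univ _⟩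
      rw [h] at hy'
      exact Finset.notMem_erase y univ hy'
  -- the two entries as variables (keeps the weight expressions in pattern form)
  obtain ⟨v₀, hv₀⟩ : ∃ v₀ : Fin n × Fin n, v₀ = (x, cN) := ⟨_, rfl⟩
  obtain ⟨v₁, hv₁⟩ : ∃ v₁ : Fin n × Fin n, v₁ = (p', cN) := ⟨_, rfl⟩
  have hv₀1 : v₀.1 = x := by rw [hv₀]
  have hv₀2 : v₀.2 = cN := by rw [hv₀]
  have hv₁1 : v₁.1 = p' := by rw [hv₁]
  have hv₁2 : v₁.2 = cN := by rw [hv₁]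
  rw [← hv₀, ← hv₁]
  -- the weight block of the tail entry `(i₁, j, v₀)`, evaluated at the point
  have hblock := grenet_tangency_weightSplit e (fun j => (Pi.single (Sum.inl j) 1 : Fin n ⊕ Fin n → ℕ))
    (fun c => (Pi.single (Sum.inr c) 1 : Fin n ⊕ Fin n → ℕ)) hn hN A' htr
    ((∑ j₁ ∈ S, (Pi.single (Sum.inl j₁) 1 : Fin n ⊕ Fin n → ℕ)
        + ∑ j₁ ∈ Tᶜ, (Pi.single (Sum.inl j₁) 1 : Fin n ⊕ Fin n → ℕ)) +
      (∑ c ∈ univ.filter (fun c : Fin n => (c : ℕ) < S.card), (Pi.single (Sum.inr c) 1 : Fin n ⊕ Fin n → ℕ)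
        + ∑ c ∈ univ.filter (fun c : Fin n => T.card ≤ (c : ℕ)), (Pi.single (Sum.inr c) 1 : Fin n ⊕ Fin n → ℕ))
      + ((Pi.single (Sum.inl v₀.1) 1 : Fin n ⊕ Fin n → ℕ) + (Pi.single (Sum.inr v₀.2) 1 : Fin n ⊕ Fin n → ℕ)))
  have h := congrArg (eval (fun v : Fin n × Fin n => if π v.2 = v.1 ∨ (v.2 = cN ∧ v.1 = π c₁) then (1 : k) else 0)) hblock
  rw [map_sum, map_zero] at h
  have hterm : ∀ z ∈ (univ : Finset (Fin N × Fin N × (Fin n × Fin n))).filter (fun z =>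
      ((∑ j₁ ∈ e.symm ((e univ).succAbove z.1), (Pi.single (Sum.inl j₁) 1 : Fin n ⊕ Fin n → ℕ)
          + ∑ j₁ ∈ (e.symm ((e ∅).succAbove z.2.1))ᶜ, (Pi.single (Sum.inl j₁) 1 : Fin n ⊕ Fin n → ℕ)) +
        (∑ c ∈ univ.filter (fun c : Fin n => (c : ℕ) < (e.symm ((e univ).succAbove z.1)).card),
            (Pi.single (Sum.inr c) 1 : Fin n ⊕ Fin n → ℕ)
          + ∑ c ∈ univ.filter (fun c : Fin n => (e.symm ((e ∅).succAbove z.2.1)).card ≤ (c : ℕ)),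
            (Pi.single (Sum.inr c) 1 : Fin n ⊕ Fin n → ℕ))
        + ((Pi.single (Sum.inl z.2.2.1) 1 : Fin n ⊕ Fin n → ℕ) + (Pi.single (Sum.inr z.2.2.2) 1 : Fin n ⊕ Fin n → ℕ)))
      = ((∑ j₁ ∈ S, (Pi.single (Sum.inl j₁) 1 : Fin n ⊕ Fin n → ℕ)
          + ∑ j₁ ∈ Tᶜ, (Pi.single (Sum.inl j₁) 1 : Fin n ⊕ Fin n → ℕ)) +
        (∑ c ∈ univ.filter (fun c : Fin n => (c : ℕ) < S.card), (Pi.single (Sum.inr c) 1 : Fin n ⊕ Fin n → ℕ)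
          + ∑ c ∈ univ.filter (fun c : Fin n => T.card ≤ (c : ℕ)), (Pi.single (Sum.inr c) 1 : Fin n ⊕ Fin n → ℕ))
        + ((Pi.single (Sum.inl v₀.1) 1 : Fin n ⊕ Fin n → ℕ) + (Pi.single (Sum.inr v₀.2) 1 : Fin n ⊕ Fin n → ℕ)))),
      eval (fun v : Fin n × Fin n => if π v.2 = v.1 ∨ (v.2 = cN ∧ v.1 = π c₁) then (1 : k) else 0)
        (C (A' z.2.2 z.1 z.2.1) *
          (perPoly (Fin n) k * (1 - Grenet.adj k n).adjugate (e.symm ((e ∅).succAbove z.2.1))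
              (e.symm ((e univ).succAbove z.1)) * X z.2.2
            - (1 - Grenet.adj k n).adjugate ∅ (e.symm ((e univ).succAbove z.1)) * X z.2.2
              * (1 - Grenet.adj k n).adjugate (e.symm ((e ∅).succAbove z.2.1)) univ))
        = A' z.2.2 z.1 z.2.1 * ((if z = (i₂, j, v₁) then 1 else 0) - (if z = (i₁, j, v₀) then 1 else 0)) := by
    rintro ⟨i'', j'', v''⟩ hz
    have hw := (Finset.mem_filter.mp hz).2
    simp only at hw ⊢
    set S'' := e.symm ((e univ).succAbove i'') with hS''def
    set T'' := e.symm ((e ∅).succAbove j'') with hT''def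
    by_cases hA0 : A' v'' i'' j'' = 0
    · rw [hA0, map_mul, eval_C, zero_mul, zero_mul]
    -- the shape of the entry: a tail entry `(univ - y, T, (y, cN))`
    have hcol : ∀ c, c < n → (if c < S''.card then 1 else 0) + (if T''.card ≤ c then 1 else 0)
        + (if c = (v''.2 : ℕ) then 1 else 0)
        = (if c < S.card then 1 else 0) + (if T.card ≤ c then 1 else 0) + (if c = S.card then (1 : ℕ) else 0) := by
      intro c hc
      have h1 := congrFun hw (Sum.inr ⟨c, hc⟩)
      rw [weightE_apply_inr, weightE_apply_inr, ite_fin_eq_eq_ite_val_eq, ite_fin_eq_eq_ite_val_eq, hv₀2, hcN,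
        ← hScard] at h1
      exact h1
    have hrow : ∀ j₁ : Fin n, (if j₁ ∈ S'' then 1 else 0) + (if j₁ ∈ T'' then 0 else 1)
        + (if j₁ = v''.1 then 1 else 0)
        = (if j₁ ∈ S then 1 else 0) + (if j₁ ∈ T then 0 else 1) + (if j₁ = x then (1 : ℕ) else 0) := by
      intro j₁
      have h1 := congrFun hw (Sum.inl j₁)
      rwa [weightE_apply_inl, weightE_apply_inl, hv₀1] at h1
    have hth : (v''.1 ∉ S'' ∧ (v''.2 : ℕ) = S''.card) ∨ (v''.1 ∈ T'' ∧ T''.card = (v''.2 : ℕ) + 1) := by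
      rw [hS''def, hT''def]; exact hsupp v'' i'' j'' hA0
    have hS''n : S''.card < n := by
      rw [hS''def]
      have := (Finset.card_lt_iff_ne_univ _).mpr (grenet_row_ne_univ e i'')
      rwa [Fintype.card_fin] at this
    obtain ⟨hs, ht, hqq⟩ := border_column_shape (by omega : T.card ≤ S.card) (by omega) hS''n hcol
      (hth.imp (fun h' => h'.2) (fun h' => h'.2))
    have htl : v''.1 ∉ S'' := by
      rcases hth with h' | h'
      · exact h'.1
      · exfalso; omega
    have hS''eq : S'' = univ.erase v''.1 := by
      apply Finset.eq_of_subset_of_card_le (fun z hz => Finset.mem_erase.mpr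
        ⟨fun h' => htl (by rw [← h']; exact hz), Finset.mem_univ _⟩)
      rw [Finset.card_erase_of_mem (Finset.mem_univ _), Finset.card_univ, Fintype.card_fin]; omega
    have hT''T : T'' = T := by
      ext j₁
      have h1 := hrow j₁
      rw [hS''eq, hi₁] at h1
      have e1 : (if j₁ ∈ univ.erase v''.1 then 1 else 0) + (if j₁ = v''.1 then 1 else 0) = (1 : ℕ) := by
        by_cases h' : j₁ = v''.1
        · rw [if_neg (by rw [h']; exact Finset.notMem_erase _ _), if_pos h']
        · rw [if_pos (Finset.mem_erase.mpr ⟨h', Finset.mem_univ _⟩), if_neg h']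
      have e2 : (if j₁ ∈ univ.erase x then 1 else 0) + (if j₁ = x then 1 else 0) = (1 : ℕ) := by
        by_cases h' : j₁ = x
        · rw [if_neg (by rw [h']; exact Finset.notMem_erase _ _), if_pos h']
        · rw [if_pos (Finset.mem_erase.mpr ⟨h', Finset.mem_univ _⟩), if_neg h']
      by_cases h2 : j₁ ∈ T'' <;> by_cases h3 : j₁ ∈ T
      · exact ⟨fun _ => h3, fun _ => h2⟩
      · rw [if_pos h2, if_neg h3] at h1; omega
      · rw [if_neg h2, if_pos h3] at h1; omega
      · exact ⟨fun h' => absurd h' h2, fun h' => absurd h' h3⟩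
    have hj : j'' = j := hCinj _ _ (by rw [← hT''def, ← hTdef]; exact hT''T)
    have hv2 : v''.2 = cN := Fin.ext (by rw [hqq, hScard, hcN])
    have hvv : v'' = (v''.1, cN) := Prod.ext rfl hv2
    -- evaluate
    rw [hv₀, hv₁, map_mul, eval_C, map_sub, map_mul, map_mul, map_mul, map_mul, eval_X, hT''T, hS''eq, hEper, hES,
      hET, hETY, hvv, one_mul, mul_one, hj]
    simp only [hπcN, hπc₁, true_and]
    by_cases hyp : v''.1 = p'
    · have hi : i'' = i₂ := hRinj _ _ (by rw [← hS''def, hS''eq, hyp, hi₂])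
      have hyx : ¬ v''.1 = x := fun h' => hxp (h'.symm.trans hyp)
      rw [if_pos hyp, if_pos (Or.inr hyp), if_neg hyx, hi, hyp, if_pos rfl,
        if_neg (fun h' => hxp (by have := congrArg (fun z => z.2.2.1) h'; exact this.symm))]
      ring
    · by_cases hyx : v''.1 = x
      · have hi : i'' = i₁ := hRinj _ _ (by rw [← hS''def, hS''eq, hyx, ← hi₁, hSdef])
        rw [if_neg hyp, if_pos (Or.inl hyx.symm), if_pos hyx, hi, hyx,
          if_neg (fun h' => hxp (by have := congrArg (fun z => z.2.2.1) h'; exact this)), if_pos rfl]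
        ring
      · rw [if_neg hyp, if_neg (fun h' => h'.elim (fun h'' => hyx h''.symm) hyp), if_neg hyx,
          if_neg (fun h' => hyp (by have := congrArg (fun z => z.2.2.1) h'; exact this)),
          if_neg (fun h' => hyx (by have := congrArg (fun z => z.2.2.1) h'; exact this))]
        ring
  rw [Finset.sum_congr rfl hterm] at h
  -- the two surviving entries
  have hxt : ((i₁, j, v₀) : Fin N × Fin N × (Fin n × Fin n)) ∈ (univ : Finset (Fin N × Fin N × (Fin n × Fin n))).filter (fun z =>
      ((∑ j₁ ∈ e.symm ((e univ).succAbove z.1), (Pi.single (Sum.inl j₁) 1 : Fin n ⊕ Fin n → ℕ)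
          + ∑ j₁ ∈ (e.symm ((e ∅).succAbove z.2.1))ᶜ, (Pi.single (Sum.inl j₁) 1 : Fin n ⊕ Fin n → ℕ)) +
        (∑ c ∈ univ.filter (fun c : Fin n => (c : ℕ) < (e.symm ((e univ).succAbove z.1)).card),
            (Pi.single (Sum.inr c) 1 : Fin n ⊕ Fin n → ℕ)
          + ∑ c ∈ univ.filter (fun c : Fin n => (e.symm ((e ∅).succAbove z.2.1)).card ≤ (c : ℕ)),
            (Pi.single (Sum.inr c) 1 : Fin n ⊕ Fin n → ℕ))
        + ((Pi.single (Sum.inl z.2.2.1) 1 : Fin n ⊕ Fin n → ℕ) + (Pi.single (Sum.inr z.2.2.2) 1 : Fin n ⊕ Fin n → ℕ)))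
      = ((∑ j₁ ∈ S, (Pi.single (Sum.inl j₁) 1 : Fin n ⊕ Fin n → ℕ)
          + ∑ j₁ ∈ Tᶜ, (Pi.single (Sum.inl j₁) 1 : Fin n ⊕ Fin n → ℕ)) +
        (∑ c ∈ univ.filter (fun c : Fin n => (c : ℕ) < S.card), (Pi.single (Sum.inr c) 1 : Fin n ⊕ Fin n → ℕ)
          + ∑ c ∈ univ.filter (fun c : Fin n => T.card ≤ (c : ℕ)), (Pi.single (Sum.inr c) 1 : Fin n ⊕ Fin n → ℕ))
        + ((Pi.single (Sum.inl v₀.1) 1 : Fin n ⊕ Fin n → ℕ) + (Pi.single (Sum.inr v₀.2) 1 : Fin n ⊕ Fin n → ℕ)))) :=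
    Finset.mem_filter.mpr ⟨Finset.mem_univ _, rfl⟩
  have hxh : ((i₂, j, v₁) : Fin N × Fin N × (Fin n × Fin n)) ∈ (univ : Finset (Fin N × Fin N × (Fin n × Fin n))).filter (fun z =>
      ((∑ j₁ ∈ e.symm ((e univ).succAbove z.1), (Pi.single (Sum.inl j₁) 1 : Fin n ⊕ Fin n → ℕ)
          + ∑ j₁ ∈ (e.symm ((e ∅).succAbove z.2.1))ᶜ, (Pi.single (Sum.inl j₁) 1 : Fin n ⊕ Fin n → ℕ)) +
        (∑ c ∈ univ.filter (fun c : Fin n => (c : ℕ) < (e.symm ((e univ).succAbove z.1)).card),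
            (Pi.single (Sum.inr c) 1 : Fin n ⊕ Fin n → ℕ)
          + ∑ c ∈ univ.filter (fun c : Fin n => (e.symm ((e ∅).succAbove z.2.1)).card ≤ (c : ℕ)),
            (Pi.single (Sum.inr c) 1 : Fin n ⊕ Fin n → ℕ))
        + ((Pi.single (Sum.inl z.2.2.1) 1 : Fin n ⊕ Fin n → ℕ) + (Pi.single (Sum.inr z.2.2.2) 1 : Fin n ⊕ Fin n → ℕ)))
      = ((∑ j₁ ∈ S, (Pi.single (Sum.inl j₁) 1 : Fin n ⊕ Fin n → ℕ)
          + ∑ j₁ ∈ Tᶜ, (Pi.single (Sum.inl j₁) 1 : Fin n ⊕ Fin n → ℕ)) +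
        (∑ c ∈ univ.filter (fun c : Fin n => (c : ℕ) < S.card), (Pi.single (Sum.inr c) 1 : Fin n ⊕ Fin n → ℕ)
          + ∑ c ∈ univ.filter (fun c : Fin n => T.card ≤ (c : ℕ)), (Pi.single (Sum.inr c) 1 : Fin n ⊕ Fin n → ℕ))
        + ((Pi.single (Sum.inl v₀.1) 1 : Fin n ⊕ Fin n → ℕ) + (Pi.single (Sum.inr v₀.2) 1 : Fin n ⊕ Fin n → ℕ)))) := by
    refine Finset.mem_filter.mpr ⟨Finset.mem_univ _, ?_⟩
    simp only
    funext z
    cases z with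
    | inl j₁ =>
      rw [weightE_apply_inl, weightE_apply_inl, hi₂, hi₁, hv₁1, hv₀1, ← hTdef]
      by_cases h1 : j₁ = p' <;> by_cases h2 : j₁ = x
      · exact absurd (h2.symm.trans h1) hxp
      · rw [if_neg (fun h => (Finset.mem_erase.mp h).1 h1), if_pos h1,
          if_pos (Finset.mem_erase.mpr ⟨h2, Finset.mem_univ _⟩), if_neg h2]
        omega
      · rw [if_pos (Finset.mem_erase.mpr ⟨h1, Finset.mem_univ _⟩), if_neg h1,
          if_neg (fun h => (Finset.mem_erase.mp h).1 h2), if_pos h2]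
        omega
      · rw [if_pos (Finset.mem_erase.mpr ⟨h1, Finset.mem_univ _⟩), if_neg h1,
          if_pos (Finset.mem_erase.mpr ⟨h2, Finset.mem_univ _⟩), if_neg h2]
    | inr c =>
      rw [weightE_apply_inr, weightE_apply_inr, hi₂, hi₁, hv₁2, hv₀2, Finset.card_erase_of_mem (Finset.mem_univ p'),
        Finset.card_erase_of_mem (Finset.mem_univ x), ← hTdef]
  have hne : ((i₂, j, v₁) : Fin N × Fin N × (Fin n × Fin n)) ≠ (i₁, j, v₀) := fun h' =>
    hxp (by have := congrArg (fun z => z.2.2.1) h'; rw [hv₁1, hv₀1] at this; exact this.symm)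
  simp only [mul_sub, Finset.sum_sub_distrib, mul_ite, mul_one, mul_zero, Finset.sum_ite_eq' _ _,
    if_pos hxh, if_pos hxt] at h
  exact sub_eq_zero.mp h

end BorderTu

end Summit.ValiantsHypothesis.Theorems.RigidityForcesSymmetry.GrenetGauge
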